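import Summits.BirchSwinnertonDyer.BirchSwinnertonDyer.Theorems.ByReductionTypeAtTwoMultTowerNS2CoinvariantsUnit
import HarnessLib

/-!
# Route `ByReductionTypeAtTwo`, crux `MultUpperHalfAtTwo` (item stmt-BirchSwinnertonDyer-19922), TOWER road, the
# «ONE BIT AT A NON-SPLIT 2» rows: KERNEL BRICK 16c — no `2`-torsion coinvariant class of ODD exponent when an element of
# `σ`-norm `q` exists (scope memo S4, fed by the tower non-norm lemma S5)

HONEST FRAMING (cell `bsd-2adic`, run/shared/lean/pub/bsd-2adic/, seat `bsd-2adic-tower-1` GEN 9, HUMAN RULINGS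
D-0036 / D-0054 / D-0074): TOOL theorems only (no definition, no named fact, no `sorry`); closes nothing by itself;
nothing booked; BSD is not proved by any of this. Module M6 (step S4) of the KERNELISATION of the MEMO binder
`MultTowerNS2.localTowerKerTwoTorsion_le_two_nonsplitTwo_of_tateUnit` (scope memo HOME/tower/SCOPE-hNS2one-kernel-GEN8.md).
Setting as in BRICKs 15/16a/16b, with `Q = q ∈ ℚ_v` the Tate parameter (`e q = 2^k u`, `u ≡ 3, 5 (mod 8)` along a ring
isomorphism `e : ℚ_v ≃ ℚ₂`).

* `false_of_odd_exponent_of_sq_eq` — **S4**: if some `f₀ ∈ K̄^{H_n ∩ Stab(t)}` has `τ₀f₀ · f₀ = q` (CASE A), then no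
  `x` of the twisted Tate module with ODD exponent (`τ₀x · x = q^a`, `a` odd) has `x² ∈ q^ℤ · (g−1)T`. Proof: the
  exponent count gives `x² = q^a · gz'/z'` with `τ₀z'·z' = 1` (twist `z` by a power of `f₀`), so `x/τ₀x = gz'/z'`; the
  explicit quadratic Hilbert 90 `z' = τ₀z₀/z₀` (BRICK 16a) makes `f = x · gz₀/z₀` a `τ₀`-invariant element of a finite
  layer `F_{n+R}`, with `∏_{i<2^{R+1}} g^i f = q^{a 2^R}` — contradicting BRICK 15 `prod_smul_ne_pow_of_tateUnit`.

References: R. Greenberg, LNM 1716 §3 (pp. 87–93); J. Neukirch, *ANT* V (1.1); scope memo S4/S5.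
-/

set_option autoImplicit false
-- the Theorems namespace of this sub repeats the summit name by design (D-0017 nested layout: Summit.<S>.<Sub>)
set_option linter.dupNamespace false

noncomputable section

open scoped Classical IntermediateField

namespace Summit.BirchSwinnertonDyer.BirchSwinnertonDyer.Theorems.MultTowerNS2

open NumberField IsDedekindDomain Field PadicInt Literature.NumberTheory.EllipticCurves
  Literature.NumberTheory.GaloisRepresentations

variable {κ : ZpExtension ℚ 2}

/-- **S4: no `2`-torsion coinvariant class of odd exponent in CASE A.** See the module docstring.
[cite: GreenbergLNM1716, §3 (pp. 87–93)] -/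
theorem false_of_odd_exponent_of_sq_eq (hκ : κ.IsCyclotomic) (v : HeightOneSpectrum (𝓞 ℚ))
    (hv : ((2 : ℕ) : 𝓞 ℚ) ∈ v.asIdeal) (n : ℕ) {g : absoluteGaloisGroup (v.adicCompletion ℚ)} {ug : ℤ_[2]ˣ}
    (hug : ((κ (resGal (K := ℚ) (v.adicCompletion ℚ) g)).toAdd : ℤ_[2]) = 2 ^ n * (ug : ℤ_[2]))
    (hgn : g ∈ localSubgroup (κ.layerSubgroup n) (v.adicCompletion ℚ))
    {t : AlgebraicClosure (v.adicCompletion ℚ)}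
    (ht : ∀ σ : absoluteGaloisGroup (v.adicCompletion ℚ), σ • t = t ∨ σ • t = -t) (ht0 : t ≠ 0) (hgt : g • t = t)
    {τ₀ : absoluteGaloisGroup (v.adicCompletion ℚ)} (hτ₀ : τ₀ ∈ localSubgroup κ.kerSubgroup (v.adicCompletion ℚ))
    (hτ₀t : τ₀ • t = -t) (p : ℕ) [Fact p.Prime] (hp : p = 2) (e : v.adicCompletion ℚ ≃+* ℚ_[p])
    {q : v.adicCompletion ℚ} (hq0 : q ≠ 0) {k : ℕ} {u : ℤ_[p]} (hq : e q = (p : ℚ_[p]) ^ k * (u : ℚ_[p]))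
    (hu : toZModPow 3 u = 3 ∨ toZModPow 3 u = 5)
    (hQtor : ∀ j : ℤ, algebraMap (v.adicCompletion ℚ) (AlgebraicClosure (v.adicCompletion ℚ)) q ^ j = 1 → j = 0)
    {f₀ : AlgebraicClosure (v.adicCompletion ℚ)} (hf₀0 : f₀ ≠ 0)
    (hf₀M : ∀ h ∈ localSubgroup (κ.layerSubgroup n) (v.adicCompletion ℚ), h • t = t → h • f₀ = f₀)
    (hf₀N : τ₀ • f₀ * f₀ = algebraMap (v.adicCompletion ℚ) (AlgebraicClosure (v.adicCompletion ℚ)) q)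
    {x : AlgebraicClosure (v.adicCompletion ℚ)} (hx0 : x ≠ 0)
    (hxL : ∀ h ∈ localSubgroup κ.kerSubgroup (v.adicCompletion ℚ), h • t = t → h • x = x)
    {a : ℤ} (ha : Odd a) (hxa : τ₀ • x * x = algebraMap (v.adicCompletion ℚ) (AlgebraicClosure (v.adicCompletion ℚ)) q ^ a)
    {j : ℤ} {z : AlgebraicClosure (v.adicCompletion ℚ)} (hz0 : z ≠ 0)
    (hzL : ∀ h ∈ localSubgroup κ.kerSubgroup (v.adicCompletion ℚ), h • t = t → h • z = z) {j' : ℤ}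
    (hzj : τ₀ • z * z = algebraMap (v.adicCompletion ℚ) (AlgebraicClosure (v.adicCompletion ℚ)) q ^ j')
    (hx2 : x ^ 2 = algebraMap (v.adicCompletion ℚ) (AlgebraicClosure (v.adicCompletion ℚ)) q ^ j * (g • z / z)) :
    False := by
  set Q : AlgebraicClosure (v.adicCompletion ℚ) := algebraMap (v.adicCompletion ℚ) (AlgebraicClosure (v.adicCompletion ℚ)) q
    with hQ
  have hQ0 : Q ≠ 0 := by rw [hQ]; exact (map_ne_zero _).mpr hq0
  have hQfix : ∀ σ : absoluteGaloisGroup (v.adicCompletion ℚ), σ • Q = Q := fun σ ↦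
    AlgEquiv.commutes (absoluteGaloisGroup.toAlgEquiv _ σ) q
  haveI hHin : (localSubgroup κ.kerSubgroup (v.adicCompletion ℚ)).Normal := by
    rw [localSubgroup_eq_comap]; exact Subgroup.Normal.comap inferInstance _
  have hHmn : ∀ m, (localSubgroup (κ.layerSubgroup m) (v.adicCompletion ℚ)).Normal := fun m ↦ by
    rw [localSubgroup_eq_comap]; exact Subgroup.Normal.comap inferInstance _
  have hile : ∀ m, localSubgroup κ.kerSubgroup (v.adicCompletion ℚ) ≤ localSubgroup (κ.layerSubgroup m) (v.adicCompletion ℚ) :=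
    fun m τ hτ ↦ by
      rw [mem_localSubgroup_iff] at hτ ⊢
      exact κ.kerSubgroup_le_layerSubgroup m hτ
  have hgit : ∀ i : ℕ, (g ^ i) • t = t := fun i ↦ by
    induction i with
    | zero => rw [pow_zero, one_smul]
    | succ i ih => rw [pow_succ, mul_smul, hgt, ih]
  have hτx0 : τ₀ • x ≠ 0 := (smul_ne_zero_iff_ne τ₀).mpr hx0
  have hgz0 : g • z ≠ 0 := (smul_ne_zero_iff_ne g).mpr hz0
  -- (1) `j = a`
  have hcob : τ₀ • (g • z / z) * (g • z / z) = 1 :=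
    flip_smul_coboundary_mul_coboundary ht hτ₀ hτ₀t hgt hQ0 (hQfix g) hz0 hzL hzj
  have hja : j = a := by
    have h1 : τ₀ • (x ^ 2) * x ^ 2 = Q ^ (2 * a) := by rw [smul_pow', ← mul_pow, hxa, ← zpow_natCast, ← zpow_mul]; ring_nf
    rw [hx2, smul_mul', smul_zpow₀', hQfix τ₀] at h1
    have h2 : Q ^ (2 * j - 2 * a) = 1 := by
      rw [zpow_sub₀ hQ0, div_eq_one_iff_eq (zpow_ne_zero _ hQ0), ← h1, two_mul, zpow_add₀ hQ0]
      linear_combination (-(Q ^ j * Q ^ j)) * hcob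
    have := hQtor _ h2
    omega
  subst hja
  -- (2) twist `z` into `U¹`: `z' = z / f₀^{j'}`
  have hf₀L : ∀ h ∈ localSubgroup κ.kerSubgroup (v.adicCompletion ℚ), h • t = t → h • f₀ = f₀ :=
    fun h hh hht ↦ hf₀M h (hile n hh) hht
  have hgf₀ : g • f₀ = f₀ := hf₀M g hgn hgt
  set z' : AlgebraicClosure (v.adicCompletion ℚ) := z * (f₀ ^ j')⁻¹ with hz'
  have hf₀j : f₀ ^ j' ≠ 0 := zpow_ne_zero _ hf₀0
  have hz'0 : z' ≠ 0 := mul_ne_zero hz0 (inv_ne_zero hf₀j)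
  have hz'L : ∀ h ∈ localSubgroup κ.kerSubgroup (v.adicCompletion ℚ), h • t = t → h • z' = z' := fun h hh hht ↦ by
    rw [hz', smul_mul', smul_inv'', smul_zpow₀', hzL h hh hht, hf₀L h hh hht]
  have hz'U : τ₀ • z' * z' = 1 := by
    have h1 : (τ₀ • f₀) ^ j' * f₀ ^ j' = Q ^ j' := by rw [← mul_zpow, hf₀N]
    have hτf₀ : (τ₀ • f₀) ^ j' ≠ 0 := zpow_ne_zero _ ((smul_ne_zero_iff_ne τ₀).mpr hf₀0)
    rw [hz', smul_mul', smul_inv'', smul_zpow₀']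
    field_simp
    linear_combination hzj - h1
  have hgz' : g • z' / z' = g • z / z := by
    rw [hz', smul_mul', smul_inv'', smul_zpow₀', hgf₀]
    field_simp
  clear_value z'
  -- (3) `x / τ₀x = g z' / z'`
  have hτx : τ₀ • x = Q ^ j / x := eq_div_of_mul_eq hx0 hxa
  have hw : x / τ₀ • x = g • z' / z' := by
    rw [hgz', hτx, div_div_eq_mul_div, ← sq, hx2]
    field_simp
  -- (4) a common finite level `n + R` for `x` and `z` (hence for `z'`, `z₀`, `f`)
  obtain ⟨R, hxR, hzR⟩ := exists_forall_mem_localSubgroup_layerSubgroup_add_smul_eq₂ (κ := κ) v n t x z hxL hzL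
  haveI := hHmn (n + R)
  have hf₀R : ∀ h ∈ localSubgroup (κ.layerSubgroup (n + R)) (v.adicCompletion ℚ), h • t = t → h • f₀ = f₀ :=
    fun h hh hht ↦ hf₀M h (localSubgroup_layerSubgroup_le_of_le v (by omega) hh) hht
  have hz'R : ∀ h ∈ localSubgroup (κ.layerSubgroup (n + R)) (v.adicCompletion ℚ), h • t = t → h • z' = z' :=
    fun h hh hht ↦ by rw [hz', smul_mul', smul_inv'', smul_zpow₀', hzR h hh hht, hf₀R h hh hht]
  -- (5) quadratic Hilbert 90: `z' = τ₀ z₀ / z₀` with `z₀ ∈ {1 + z'⁻¹, t}`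
  obtain ⟨z₀, hz₀0, hz₀L, hz₀R, hz₀eq⟩ : ∃ z₀ : AlgebraicClosure (v.adicCompletion ℚ), z₀ ≠ 0 ∧
      (∀ h ∈ localSubgroup κ.kerSubgroup (v.adicCompletion ℚ), h • t = t → h • z₀ = z₀) ∧
      (∀ h ∈ localSubgroup (κ.layerSubgroup (n + R)) (v.adicCompletion ℚ), h • t = t → h • z₀ = z₀) ∧
      z' = τ₀ • z₀ / z₀ := by
    obtain ⟨h1, h2⟩ := eq_flip_smul_div_of_flip_smul_mul_eq_one τ₀ hz'0 hz'U
    by_cases h0 : 1 + z'⁻¹ = 0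
    · exact ⟨t, ht0, fun h _ hht ↦ hht, fun h _ hht ↦ hht, h2 h0 t ht0 hτ₀t⟩
    · refine ⟨1 + z'⁻¹, h0, fun h hh hht ↦ ?_, fun h hh hht ↦ ?_, h1 h0⟩
      · rw [smul_add, smul_one, smul_inv'', hz'L h hh hht]
      · rw [smul_add, smul_one, smul_inv'', hz'R h hh hht]
  have hτz₀ : τ₀ • z₀ = z' * z₀ := by rw [hz₀eq, div_mul_cancel₀ _ hz₀0]
  -- (6) `f = x · g z₀ / z₀` is `τ₀`-invariant and lies in `F_{n+R}`
  set f : AlgebraicClosure (v.adicCompletion ℚ) := x * (g • z₀ / z₀) with hf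
  have hgz₀0 : g • z₀ ≠ 0 := (smul_ne_zero_iff_ne g).mpr hz₀0
  have h1 : τ₀ • x * g • z' = x * z' := by
    have h := hw
    rw [div_eq_div_iff hτx0 hz'0] at h
    linear_combination -h
  have hτf : τ₀ • f = f := by
    rw [hf, smul_mul', smul_div₀', flip_smul_smul_comm ht hτ₀ hτ₀t hgt hz₀L, hτz₀, smul_mul']
    field_simp
    linear_combination h1
  have hfR' : ∀ h ∈ localSubgroup (κ.layerSubgroup (n + R)) (v.adicCompletion ℚ), h • t = t → h • f = f := by
    intro h hh hht
    rw [hf, smul_mul', smul_div₀', hxR h hh hht, hz₀R h hh hht,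
      smul_mem_of_forall_mem_smul_eq ht _ hz₀R g h hh hht]
  have hfR : ∀ h ∈ localSubgroup (κ.layerSubgroup (n + R)) (v.adicCompletion ℚ), h • f = f := by
    intro h hh
    rcases ht h with hht | hht
    · exact hfR' h hh hht
    · have hmem : τ₀⁻¹ * h ∈ localSubgroup (κ.layerSubgroup (n + R)) (v.adicCompletion ℚ) :=
        Subgroup.mul_mem _ (Subgroup.inv_mem _ (hile _ hτ₀)) hh
      have hfix : (τ₀⁻¹ * h) • t = t := by
        rw [mul_smul, hht, smul_neg, inv_smul_eq_smul_of_smul_eq_or (Or.inr hτ₀t), hτ₀t, neg_neg]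
      have h2 := hfR' _ hmem hfix
      rw [mul_smul, inv_smul_eq_iff] at h2
      rw [h2, hτf]
  have hfR1 : ∀ h ∈ localSubgroup (κ.layerSubgroup (n + (R + 1))) (v.adicCompletion ℚ), h • f = f :=
    fun h hh ↦ hfR h (localSubgroup_layerSubgroup_le_of_le v (by omega) hh)
  -- (7) `N_{R+1}(f) = (Q^j)^{2^R}`
  have hgRmem : g ^ 2 ^ R ∈ localSubgroup (κ.layerSubgroup (n + R)) (v.adicCompletion ℚ) :=
    (pow_mem_localSubgroup_layerSubgroup_iff (κ := κ) v n R hug _).mpr dvd_rfl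
  have hgR1mem : g ^ 2 ^ (R + 1) ∈ localSubgroup (κ.layerSubgroup (n + R)) (v.adicCompletion ℚ) :=
    (pow_mem_localSubgroup_layerSubgroup_iff (κ := κ) v n R hug _).mpr (pow_dvd_pow 2 (Nat.le_succ R))
  have hgRx : (g ^ 2 ^ R) • x = x := hxR _ hgRmem (hgit _)
  have hgRz : (g ^ 2 ^ R) • z = z := hzR _ hgRmem (hgit _)
  have hgR1z₀ : (g ^ 2 ^ (R + 1)) • z₀ = z₀ := hz₀R _ hgR1mem (hgit _)
  have hprodz : (∏ i ∈ Finset.range (2 ^ R), (g ^ i) • (g • z / z)) = 1 := by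
    rw [Finset.prod_congr rfl fun i _ ↦ show (g ^ i) • (g • z / z) = (g ^ i) • (g • z) * (g ^ i) • z⁻¹ by
        rw [div_eq_mul_inv, smul_mul'], Finset.prod_mul_distrib, prod_smul_smul_eq g (2 ^ R) hgRz, prod_smul_inv,
      mul_inv_cancel₀]
    exact Finset.prod_ne_zero_iff.mpr fun i _ ↦ (smul_ne_zero_iff_ne _).mpr hz0
  have hNx : (∏ i ∈ Finset.range (2 ^ (R + 1)), (g ^ i) • x) = (Q ^ j) ^ 2 ^ R := by
    rw [pow_succ', prod_smul_range_two_mul, pow_smul_prod_smul_eq g (2 ^ R) hgRx, ← sq, sq, ← prod_smul_mul, ← sq,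
      hx2, prod_smul_mul, hprodz, mul_one, prod_smul_eq_pow_of_smul_eq g (2 ^ R) (by rw [smul_zpow₀', hQfix])]
  have hNf : (∏ i ∈ Finset.range (2 ^ (R + 1)), (g ^ i) • f) = (Q ^ j) ^ 2 ^ R := by
    rw [hf, prod_smul_mul, hNx, Finset.prod_congr rfl fun i _ ↦ show (g ^ i) • (g • z₀ / z₀) =
        (g ^ i) • (g • z₀) * (g ^ i) • z₀⁻¹ by rw [div_eq_mul_inv, smul_mul'], Finset.prod_mul_distrib,
      prod_smul_smul_eq g (2 ^ (R + 1)) hgR1z₀, prod_smul_inv, mul_inv_cancel₀, mul_one]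
    exact Finset.prod_ne_zero_iff.mpr fun i _ ↦ (smul_ne_zero_iff_ne _).mpr hz₀0
  -- (8) contradiction with the tower non-norm lemma (BRICK 15), at level `R + 1`, exponent `|j|` odd
  obtain ⟨j₀, hj₀⟩ : ∃ j₀ : ℕ, j = j₀ ∨ j = -j₀ := ⟨j.natAbs, Int.natAbs_eq j⟩
  have hj₀odd : Odd j₀ := by
    rcases hj₀ with h | h
    · exact_mod_cast (h ▸ ha : Odd (j₀ : ℤ))
    · have : Odd (-(j₀ : ℤ)) := h ▸ ha
      exact_mod_cast (odd_neg.mp this)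
  have hpow : (Q ^ (j₀ : ℤ)) ^ 2 ^ R =
      algebraMap (v.adicCompletion ℚ) (AlgebraicClosure (v.adicCompletion ℚ)) (q ^ (2 ^ (R + 1 - 1) * j₀)) := by
    rw [Nat.add_sub_cancel, zpow_natCast, hQ, ← map_pow, ← map_pow, ← pow_mul, mul_comm]
  rcases hj₀ with h | h
  · refine prod_smul_ne_pow_of_tateUnit hκ v hv p hp e hq hu n hug (R := R + 1) (by omega) hj₀odd hfR1 ?_
    rw [hNf, h, hpow]
  · have hfR1' : ∀ h ∈ localSubgroup (κ.layerSubgroup (n + (R + 1))) (v.adicCompletion ℚ), h • f⁻¹ = f⁻¹ :=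
      fun h hh ↦ by rw [smul_inv'', hfR1 h hh]
    refine prod_smul_ne_pow_of_tateUnit hκ v hv p hp e hq hu n hug (R := R + 1) (by omega) hj₀odd hfR1' ?_
    rw [prod_smul_inv, hNf, h, ← hpow, zpow_neg, inv_pow, inv_inv]

end Summit.BirchSwinnertonDyer.BirchSwinnertonDyer.Theorems.MultTowerNS2

end
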